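import Summits.QuantumFields.YangMills.Theorems.FiniteRankMirrorPeeling
import HarnessLib

/-!
# Route `FiniteRankMirror`, LINE g9-1b «Markov peeling» — the support item `MirrorPeeling`

Ideator seat ym-idea-8 (generation 9, lens «dual»).  The route's support item
`Summit.QuantumFields.YangMills.Theses.FiniteRankMirror.MirrorPeeling` (stmt-QuantumFields-23848) is the item form of
`FiniteRankMirrorPeeling.mirror_peel`: for two bounded continuous cylinders carried by ONE positive-time cube `Q`,
`|Cov_T(F₁∘Θ₀, F₂)| ≤ 2‖kerE_Q F₁ − p₁‖₂ · ‖kerE_Q F₂ − p₂‖₂` (Markov mirror factorisation + reflection invariance +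
Cauchy–Schwarz; no reflection positivity).

HONEST FRAMING: folklore DLR bookkeeping; nothing of E0′, (RM), NT or the mass gap is proved here; no summit is proved by
this line; not Clay.
-/

set_option autoImplicit false

/-- **Mirror peeling** — the support item `MirrorPeeling` of route `FiniteRankMirror` (stmt-QuantumFields-23848, LINE g9-1b
of ideator seat ym-idea-8). [folklore] -/
theorem Summit.QuantumFields.YangMills.Theorems.finiteRankMirror_mirrorPeeling :
    Summit.QuantumFields.YangMills.Theses.FiniteRankMirror.MirrorPeeling := by
  intro G _ _ _ _
  letI : MeasurableSpace G := borel G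
  haveI : BorelSpace G := ⟨rfl⟩
  intro r β L c b hc0 hc F₁ F₂ M₁ M₂ S₁ S₂ hF₁ hF₂ hM₁ hM₂ hS₁ hS₂ hW₁ hW₂ p₁ p₂
  exact Summit.QuantumFields.YangMills.Cruxes.FiniteRankMirrorPeeling.mirror_peel G r β L c b hc0 hc hF₁ hF₂ hM₁ hM₂
    hS₁ hS₂ hW₁ hW₂ p₁ p₂
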